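import Summits.BirchSwinnertonDyer.BirchSwinnertonDyer.Theorems.ClassRecordThreeEulerHalvesAtThreeCartanTorusCubeCutPSModPhantom
import Summits.BirchSwinnertonDyer.BirchSwinnertonDyer.Theorems.ClassRecordThreeEulerHalvesAtThreeCartanTorusCubeCutSteinbergSimple
import Summits.BirchSwinnertonDyer.BirchSwinnertonDyer.Theorems.ClassRecordThreeEulerHalvesAtThreeCartanTorusCubeCutPSModThree
import HarnessLib

/-!
# Crux 23422 line `cartan` v9, stub (F2a), PRINCIPAL-SERIES half of the torus-cube cut — the STEINBERG MAP `Φ̄ : 𝔽₃^{P¹(𝔽_q)} → X/3X`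
# of a phantom Borel-fixed vector: reduction mod 3, orbit vectors, equivariance, `Φ̄(𝟙) = 0`, and injectivity on `I₀`

Seat `bsd-stepL-tam3-p1` g21 (LINE OWNER of crux 23422; `--supports stmt-BirchSwinnertonDyer-23422 --as helper`). Second file of the
construction of the mod-3 line `X_M` for cartan-f2a g0's reductions `…PSLine*`:
* §1 reduction mod `3` is cartan-f2a g0's `PS.red` ∕ `PS.redEnd` (`…PSModThree`, imported; thin wrappers in the `ThreeDvd` spelling);
* §2 orbit vectors of a vector `f₀` fixed mod `3` by the stabiliser of `inf ∈ P¹` (`…PSModPhantom.phantom_stab`): `vbar p = red(ρ(g_p) f₀)`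
  is independent of the choice and `redEnd (ρ h) (vbar p) = vbar (h • p)`;
* §3 the `𝔽₃`-linear map `Phi c = Σ_p c(p)·vbar p` (sum along `Steinberg.optEquiv`): `Phi (ind p) = vbar p`, equivariance
  `redEnd (ρ h) (Phi c) = Phi (tr h c)`, **`Phi one = 0`** (a `G`-fixed vector of `X̄` vanishes by `noFixedVectorModThree`), and
  **injectivity on the augmentation module**: `tot c = 0`, `Phi c = 0` ⇒ `c = 0` (else the Steinberg engine gives `I₀ ⊆ ker`, all
  `vbar p` equal, `(q+1)·vbar inf = Phi one = 0`, `f₀ ∈ 3X`).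
HONEST FRAMING: finite-group linear algebra over `𝔽₃` on one lattice; S-K1′ is NOT proved here; no summit statement, no route item and
no registered stub is proved; BSD is proved for no curve. [folklore; background: cite: Bump1997, §4.1]
-/

namespace Summit.BirchSwinnertonDyer.BirchSwinnertonDyer.Theorems.CartanTorusCubeCut.PSMod

open Summit.BirchSwinnertonDyer.BirchSwinnertonDyer.Theorems.CartanDegree
open Summit.BirchSwinnertonDyer.BirchSwinnertonDyer.Theorems.CartanTorusCubeCut
open Summit.BirchSwinnertonDyer.BirchSwinnertonDyer.Theorems.CartanTorusCubeCut.Steinberg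
open scoped LinearAlgebra.Projectivization

set_option linter.dupNamespace false
set_option autoImplicit false

noncomputable section

open scoped Classical

/-! ### §1 Reduction mod 3 (cartan-f2a g0's `PS.red` ∕ `PS.redEnd` of `…PSModThree`) -/

section Red
variable {d : ℕ}

/-- `ker red = 3X` in the `ThreeDvd` spelling. -/
theorem red_eq_zero_iff' (x : Fin d → ℤ) : PS.red d x = 0 ↔ ThreeDvd x := PS.red_eq_zero_iff d x

/-- `red x = red y ↔ x − y ∈ 3X`. -/
theorem red_eq_red_iff (x y : Fin d → ℤ) : PS.red d x = PS.red d y ↔ ThreeDvd (x - y) := PS.red_sub_eq_zero_iff d x y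

/-- compatibility, in the direction `red (f x) = redEnd f (red x)`. -/
theorem red_map (f : Module.End ℤ (Fin d → ℤ)) (x : Fin d → ℤ) : PS.red d (f x) = PS.redEnd d f (PS.red d x) :=
  (PS.redEnd_red d f x).symm

end Red

variable {q : ℕ} [Fact q.Prime]

omit [Fact q.Prime] in
/-- `noFixedVectorModThree` read in `X̄` (cartan-f2a's `PS.red_eq_zero_of_fixed`, for an arbitrary vector of `X̄`). -/
theorem red_fixed_eq_zero (𝓛 : CartanTorusLattice q) (v : Fin 𝓛.d → ZMod 3)
    (hv : ∀ g : G q, PS.redEnd 𝓛.d (𝓛.ρ g) v = v) : v = 0 := by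
  obtain ⟨x, rfl⟩ := PS.red_surjective 𝓛.d v
  exact PS.red_eq_zero_of_fixed 𝓛 x hv

/-! ### §2 Orbit vectors of a phantom Borel-fixed vector -/

/-- the stabiliser of `inf = [1:0]`: `g • inf = inf ↔ g₁₀ = 0`. -/
theorem smul_inf_eq_inf_iff (g : G q) : g • (inf : P1 q) = inf ↔ (g : Mat q) 1 0 = 0 := by
  rw [inf, smul_mk_eq, Projectivization.mk_eq_mk_iff']
  constructor
  · rintro ⟨a, ha⟩
    have := congrFun ha 1
    simp [Matrix.mulVec, dotProduct] at this
    exact this.symm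
  · intro h
    refine ⟨(g : Mat q) 0 0, ?_⟩
    ext i
    fin_cases i <;> simp [Matrix.mulVec, dotProduct, h]

/-- `tot (ind p) = 1`. -/
theorem tot_ind (p : P1 q) : tot (ind p) = 1 := by
  rcases eq_inf_or_fin p with rfl | ⟨s, rfl⟩
  · rw [tot]
    have h0 : ∀ x : ZMod q, ind (inf : P1 q) (fin x) = 0 := fun x => by
      simp only [ind]; exact if_neg (fin_ne_inf x)
    have h1 : ind (inf : P1 q) inf = 1 := by simp [ind]
    simp only [h0, Finset.sum_const_zero, add_zero, h1]
  · rw [tot]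
    have hinf : ind (fin s) (inf : P1 q) = 0 := by
      simp only [ind]; exact if_neg (fin_ne_inf s).symm
    have hs : ind (fin s) (fin s : P1 q) = 1 := by simp [ind]
    have hb : ∀ b : ZMod q, b ≠ s → ind (fin s) (fin b : P1 q) = 0 := fun b hb => by
      simp only [ind]; exact if_neg (fun h => hb (fin_injective h))
    rw [hinf, zero_add, Finset.sum_eq_single s, hs]
    · intro b _ hbs; exact hb b hbs
    · intro h; exact absurd (Finset.mem_univ s) h

section Orbit
variable (𝓛 : CartanTorusLattice q) (f₀ : Fin 𝓛.d → ℤ)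
variable (hstab : ∀ g : G q, (g : Mat q) 1 0 = 0 → ThreeDvd (𝓛.ρ g f₀ - f₀))

/-- a group element moving `inf` to `p`. -/
def mover (p : P1 q) : G q := Classical.choose (exists_eq_smul_inf p)

/-- `mover p • inf = p`. -/
theorem mover_smul (p : P1 q) : mover p • (inf : P1 q) = p := (Classical.choose_spec (exists_eq_smul_inf p)).symm

/-- the orbit vector at `p`, reduced mod `3`: `red (ρ(mover p) f₀)`. -/
def vbar (p : P1 q) : Fin 𝓛.d → ZMod 3 := PS.red 𝓛.d (𝓛.ρ (mover p) f₀)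

include hstab

/-- **independence of the choice**: `red (ρ(g) f₀) = vbar (g • inf)`. -/
theorem red_rho_f0 (g : G q) : PS.red 𝓛.d (𝓛.ρ g f₀) = vbar 𝓛 f₀ (g • inf) := by
  rw [vbar, red_eq_red_iff]
  set m := mover (g • (inf : P1 q)) with hm
  have hm' : m • (inf : P1 q) = g • inf := mover_smul _
  have h10 : ((m⁻¹ * g : G q) : Mat q) 1 0 = 0 := by
    rw [← smul_inf_eq_inf_iff, mul_smul, ← hm', inv_smul_smul]
  have h := (hstab _ h10).map (𝓛.ρ m)
  rwa [map_sub, ← Module.End.mul_apply, ← map_mul, mul_inv_cancel_left] at h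

/-- **equivariance of the orbit vectors**: `redEnd (ρ h) (vbar p) = vbar (h • p)`. -/
theorem redEnd_rho_vbar (h : G q) (p : P1 q) : PS.redEnd 𝓛.d (𝓛.ρ h) (vbar 𝓛 f₀ p) = vbar 𝓛 f₀ (h • p) := by
  rw [vbar, ← red_map, ← Module.End.mul_apply, ← map_mul, red_rho_f0 𝓛 f₀ hstab, mul_smul, mover_smul]

omit hstab in
/-- `vbar inf = red f₀` (when `f₀` is fixed mod 3 by the stabiliser). -/
theorem vbar_inf (hstab : ∀ g : G q, (g : Mat q) 1 0 = 0 → ThreeDvd (𝓛.ρ g f₀ - f₀)) :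
    vbar 𝓛 f₀ (inf : P1 q) = PS.red 𝓛.d f₀ := by
  have := red_rho_f0 𝓛 f₀ hstab 1
  rw [one_smul, map_one, Module.End.one_apply] at this
  exact this.symm

/-! ### §3 The Steinberg map `Φ̄` -/

omit hstab in
/-- `Φ̄(c) = Σ_p c(p)·vbar p`, summed along `optEquiv : Option 𝔽_q ≃ P¹`. -/
def Phi : (P1 q → ZMod 3) →ₗ[ZMod 3] (Fin 𝓛.d → ZMod 3) where
  toFun c := ∑ o : Option (ZMod q), c (optEquiv o) • vbar 𝓛 f₀ (optEquiv o)
  map_add' c c' := by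
    rw [← Finset.sum_add_distrib]
    exact Finset.sum_congr rfl (fun o _ => by rw [Pi.add_apply, add_smul])
  map_smul' a c := by
    rw [Finset.smul_sum]
    exact Finset.sum_congr rfl (fun o _ => by rw [Pi.smul_apply, smul_eq_mul, mul_smul]; rfl)

omit hstab in
/-- `Phi` unfolded. -/
theorem Phi_apply (c : P1 q → ZMod 3) :
    Phi 𝓛 f₀ c = ∑ o : Option (ZMod q), c (optEquiv o) • vbar 𝓛 f₀ (optEquiv o) := rfl

omit hstab in
/-- `Φ̄` of an indicator is the orbit vector. -/
theorem Phi_ind (p : P1 q) : Phi 𝓛 f₀ (ind p) = vbar 𝓛 f₀ p := by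
  rw [Phi_apply]
  rw [Finset.sum_eq_single (optEquiv.symm p)]
  · rw [Equiv.apply_symm_apply, ind, if_pos rfl, one_smul]
  · intro o _ ho
    rw [ind, if_neg, zero_smul]
    intro h
    apply ho
    rw [← h, Equiv.symm_apply_apply]
  · intro h; exact absurd (Finset.mem_univ _) h

/-- **equivariance**: `redEnd (ρ h) (Φ̄ c) = Φ̄ (tr h c)`. -/
theorem redEnd_rho_Phi (h : G q) (c : P1 q → ZMod 3) :
    PS.redEnd 𝓛.d (𝓛.ρ h) (Phi 𝓛 f₀ c) = Phi 𝓛 f₀ (tr h c) := by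
  rw [Phi_apply, Phi_apply, map_sum]
  simp_rw [map_smul, redEnd_rho_vbar 𝓛 f₀ hstab]
  -- reindex along the permutation of `Option 𝔽_q` induced by `h`
  let σ : Option (ZMod q) ≃ Option (ZMod q) :=
    (optEquiv.trans (MulAction.toPerm (h : G q))).trans optEquiv.symm
  have hσ : ∀ o, optEquiv (σ o) = h • optEquiv o := fun o => by
    show optEquiv (optEquiv.symm (MulAction.toPerm (h : G q) (optEquiv o))) = _
    rw [Equiv.apply_symm_apply]
    rfl
  calc ∑ o, c (optEquiv o) • vbar 𝓛 f₀ (h • optEquiv o)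
      = ∑ o, (tr h c) (optEquiv (σ o)) • vbar 𝓛 f₀ (optEquiv (σ o)) :=
        Finset.sum_congr rfl (fun o _ => by rw [hσ, tr_apply, inv_smul_smul])
    _ = ∑ o, (tr h c) (optEquiv o) • vbar 𝓛 f₀ (optEquiv o) :=
        Equiv.sum_comp σ (fun o => (tr h c) (optEquiv o) • vbar 𝓛 f₀ (optEquiv o))

/-- **`Φ̄(𝟙) = 0`**: the sum of the orbit vectors is `G`-fixed, hence zero (`noFixedVectorModThree`). -/
theorem Phi_one : Phi 𝓛 f₀ (one : P1 q → ZMod 3) = 0 := by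
  apply red_fixed_eq_zero 𝓛
  intro g
  rw [redEnd_rho_Phi 𝓛 f₀ hstab, tr_one]

/-- `Φ̄` only sees the augmentation class: `Φ̄ c = Φ̄ (c − a·𝟙)`. -/
theorem Phi_sub_smul_one (c : P1 q → ZMod 3) (a : ZMod 3) : Phi 𝓛 f₀ (c - a • one) = Phi 𝓛 f₀ c := by
  rw [map_sub, map_smul, Phi_one 𝓛 f₀ hstab, smul_zero, sub_zero]

/-- **injectivity on the augmentation module** (`3 ∤ q + 1`, `f₀ ∉ 3X`): `tot c = 0`, `Φ̄ c = 0` ⇒ `c = 0`. -/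
theorem Phi_injective_on_aug (hq3 : ¬ 3 ∣ q + 1) (hf0 : ¬ ThreeDvd f₀) (c : P1 q → ZMod 3) (hc : tot c = 0)
    (hΦ : Phi 𝓛 f₀ c = 0) : c = 0 := by
  by_contra hne
  -- the kernel restricted to `I₀` is a non-zero `G`-stable subspace
  let N : Submodule (ZMod 3) (P1 q → ZMod 3) :=
    { carrier := {c | tot c = 0 ∧ Phi 𝓛 f₀ c = 0}
      add_mem' := by
        rintro a b ⟨ha, ha'⟩ ⟨hb, hb'⟩
        exact ⟨by rw [tot_add, ha, hb, add_zero], by rw [map_add, ha', hb', add_zero]⟩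
      zero_mem' := ⟨by simp [tot], by rw [map_zero]⟩
      smul_mem' := by
        rintro a b ⟨hb, hb'⟩
        exact ⟨by rw [tot_smul, hb, mul_zero], by rw [map_smul, hb', smul_zero]⟩ }
  have hN : ∀ g : G q, ∀ f ∈ N, tr g f ∈ N := by
    rintro g f ⟨hf, hf'⟩
    exact ⟨by rw [tot_tr, hf], by rw [← redEnd_rho_Phi 𝓛 f₀ hstab, hf', map_zero]⟩
  have hN0 : ∀ f ∈ N, tot f = 0 := fun f hf => hf.1
  have hneN : ∃ f ∈ N, f ≠ 0 := ⟨c, ⟨hc, hΦ⟩, hne⟩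
  have hall := steinberg_augmentation_simple hq3 N hN hN0 hneN
  -- every `ind (fin t) − ind inf` lies in the kernel, so all orbit vectors agree
  have hv : ∀ t : ZMod q, vbar 𝓛 f₀ (fin t) = vbar 𝓛 f₀ inf := by
    intro t
    have hmem := hall (ind (fin t) - ind inf) (by
      rw [show ind (fin t) - ind (inf : P1 q) = ind (fin t) + (-1 : ZMod 3) • ind inf by
        rw [neg_one_smul, sub_eq_add_neg], tot_add, tot_smul, tot_ind, tot_ind]; ring)
    have := hmem.2
    rw [map_sub, Phi_ind, Phi_ind, sub_eq_zero] at this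
    exact this
  -- `Φ̄ one = (q+1)·vbar inf = 0`
  have hsum : Phi 𝓛 f₀ (one : P1 q → ZMod 3) = ((q : ZMod 3) + 1) • vbar 𝓛 f₀ inf := by
    rw [Phi_apply, Fintype.sum_option]
    simp only [one, one_smul]
    have e : ∀ t : ZMod q, vbar 𝓛 f₀ (optEquiv (some t)) = vbar 𝓛 f₀ inf := fun t => hv t
    rw [Finset.sum_congr rfl (fun t _ => e t), Finset.sum_const, Finset.card_univ, ZMod.card, add_smul, one_smul,
      add_comm, ← Nat.cast_smul_eq_nsmul (ZMod 3)]
    rfl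
  rw [Phi_one 𝓛 f₀ hstab] at hsum
  have hq1 := natCast_add_one_ne_zero (q := q) hq3
  have hinf : vbar 𝓛 f₀ (inf : P1 q) = 0 := by
    have := congrArg (fun v => ((q : ZMod 3) + 1)⁻¹ • v) hsum
    simp only [smul_zero, smul_smul, inv_mul_cancel₀ hq1, one_smul] at this
    exact this.symm
  rw [vbar_inf 𝓛 f₀ hstab, red_eq_zero_iff'] at hinf
  exact hf0 hinf

end Orbit

end

end Summit.BirchSwinnertonDyer.BirchSwinnertonDyer.Theorems.CartanTorusCubeCut.PSMod
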